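import Mathlib
import Summits.Ventures.HodgeRepro.Tier4.Line3.Defs
import Summits.Ventures.HodgeRepro.Tier4.Line3.KMDatumS
import Summits.Ventures.HodgeRepro.Tier4.Line3.HeckeEquivarianceLemmas
import Summits.Ventures.HodgeRepro.Tier4.Common.TargetCalculus
import Summits.Ventures.HodgeRepro.Tier4.Common.TargetBall

/-!
# Tier4/Line3/HeckeEquivariance — lemma L3.1 `pd_heckeTranslate` of LINE L3 (Hecke equivariance of theta series)

Blind re-derivation cell `pub-hodge-repro`, Tier 4 «PROVE THE STEP» (README §9–§10), seat t4-L3-p2 (gen 0), seated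
against LINE L3 (`Tier4/Line3/Skeleton.lean` v0.9, sha256 2a72f2df757f9b35dc45581d457b806bb6ca5e414894548e5bc80727a8b1db53,
944 l.; lead S12104 / S12121: «t4-L3-p2 … then takes L3.1 `pd_heckeTranslate`»).  The line's definitions are imported
from `Tier4/Line3/Defs.lean` (+ `Tier4/Line3/KMDatum.lean`), the calculus on the target's objects from t4-typer-2's
`Tier4/Common/TargetCalculus.lean` (`comp_heckeTranslate`, `pd_add`, `pd_smul`, `pd_const`, `pd_comp`) and
`Tier4/Common/TargetBall.lean` (`actM_mem_ball`, `differentiableOn_actM`, `toBallMat_J`, `complexConj_intertwines`); the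
helper lemmas (§1–§5 of the proof below) are in `Tier4/Line3/HeckeEquivarianceLemmas.lean` (split off by the gate's
400-line rule for files with proofs).

THE LEMMA (skeleton v0.9 L747, statement verbatim): `theorem T4Data.pd_heckeTranslate (D : X.ThetaData) :
X.HeckeEquivariant D.Φ` — for every corner `i`, embedding `σ ∈ T i` and coefficient function `c` with the
identification `(a_i)^* dz_σ = θ(c)` on the ball, `Γ`-invariance, weight `+1` under `E′^1` and a locally uniform
summable majorant, and every Hecke element `h` of any level `Γ′ ≤ Γ`: the `σ`-coordinate form of the Hecke translate
`T_h a_i` is the theta series of the moved coefficient function `h · c` (`heckeAct`), `pd k (comp (T i) σ (T_h a_i)) z =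
theta Φ (heckeAct h c) z k` for `z ∈ 𝔹`.

PROOF.  (1) `comp` commutes with `heckeTranslate` (`comp_heckeTranslate`), so the left side is `pd k` of the finite
sum `Σ_terms n • Σ_{r ∈ R} u ∘ actM (M r)` with `u = comp (T i) σ (a i)`, `M r = toBallMat τ₀ C r`; `pd` distributes
over the list sum, the `ℤ`-multiple and the `Finset` sum (§1) because every `u ∘ actM (M r)` is differentiable at
`z ∈ 𝔹`: `u` is holomorphic on the ball (`IsAlbaneseLift`), `actM (M r)` is holomorphic on the ball and maps it into
itself (`differentiableOn_actM`, `actM_mem_ball`) since `M r` is unitary for `J` (§4: a coset representative of a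
Hecke element of level `Γ′` is a product `γ₁ g γ₂` of elements of `U(H)(E′)`; `toBallMat_J`).  (2) For one
representative (§6): the chain rule `pd k (u ∘ actM M) z = Σ_l pd l u (actM M z) · pd k (actM M ·)_l z` (`pd_comp`),
the identification AT THE POINT `actM M z ∈ 𝔹` (no termwise differentiation), the finite sum through the absolutely
convergent series, then the reindexing `o ↦ r · o` of the lines (§3: `lineStep` is an equivalence relation, `x ↦ r x`
descends to a bijection of `Line` because `r` is a unit — `H` is a unit by anisotropy), the line-invariance of the
summand `c x · Φ(y(x), z)_l` (weight `+1` of `c` against weight `−1` of the datum, `datum_smul`, with `‖τ₀ t‖ = 1`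
for `c′(t) t = 1` by `complexConj_intertwines`), `y(r x) = M(r) y(x)` and `ThetaData.equiv` at `y = y(x)`:
`pd k (u ∘ actM (M r)) z = Σ'_{lines} c (r x) · Φ(y(x), z)_k`, a summable series.  (3) Summing over the representatives
and the terms, the finite sums pass through the `tsum` (§5) and the right side is `theta Φ (heckeAct h c) z k`.
The hypotheses of `HeckeEquivariant` used: the identification, the weight and the majorant (pointwise, on the compact
`{z}`); `Γ`-invariance of `c` is not needed.  No printed input enters this module.

Nothing here says anything about the status of the Hodge conjecture for CM abelian varieties, which is NOT proved
(HC_CM is NOT proved by anyone in this repository).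
-/

set_option autoImplicit false

noncomputable section

namespace Summit.Ventures.HodgeRepro.Tier4.Line3

open Summit.Ventures.HodgeRepro.Tier4
open Matrix
open scoped ComplexConjugate

namespace HeckeEquivariance

/-! ### 6. One coset representative: the chain rule, the identification at `actM M z`, `equiv`, the reindexing -/

section Main

variable (X : T4Data)

/-- **One coset representative `r ∈ U(H)(E′)`**: the `k`-th partial derivative of `u ∘ actM (M r)` at `z ∈ 𝔹` is the
theta series of the moved coefficient function `x ↦ c (r *ᵥ x)`, and that series is summable. -/
theorem pd_comp_actM (Φ : KMDatumS) (c : (Fin 3 → X.E) → ℂ) (u : (Fin 2 → ℂ) → ℂ)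
    (hud : DifferentiableOn ℂ u ball)
    (hid : ∀ z ∈ ball, ∀ k, pd k u z = X.theta Φ c z k)
    (hw : ∀ t : X.E, X.c t * t = 1 → ∀ x, c (t • x) = c x)
    (hsum : ∀ z ∈ ball, ∀ k,
      Summable fun o : X.Line => ‖c (Quot.out o) * datumS Φ (X.ballCoord (Quot.out o)) z k‖)
    (hequiv : ∀ M : Matrix (Fin 3) (Fin 3) ℂ, IsUnitaryOf (starRingAut : ℂ ≃+* ℂ) J M →
      ∀ (y : Fin 3 → ℂ) (z : Fin 2 → ℂ), z ∈ ball → ∀ l,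
        (∑ k : Fin 2, datumS Φ (M *ᵥ y) (actM M z) k * pd l (fun w => actM M w k) z) = datumS Φ y z l)
    {r : Matrix (Fin 3) (Fin 3) X.E} (hr : IsUnitaryOf X.c X.H r) {z : Fin 2 → ℂ} (hz : z ∈ ball)
    (k : Fin 2) :
    pd k (u ∘ actM (toBallMat X.τ₀ X.C r)) z =
      ∑' o : X.Line, c (r *ᵥ Quot.out o) * datumS Φ (X.ballCoord (Quot.out o)) z k ∧
    Summable (fun o : X.Line => c (r *ᵥ Quot.out o) * datumS Φ (X.ballCoord (Quot.out o)) z k) := by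
  have hM : (toBallMat X.τ₀ X.C r)ᴴ * J * toBallMat X.τ₀ X.C r = J := toBallMat_J_of_unitary X hr
  have hMz : actM (toBallMat X.τ₀ X.C r) z ∈ ball := actM_mem_ball hM hz
  have hφ : DifferentiableAt ℂ (actM (toBallMat X.τ₀ X.C r)) z :=
    (differentiableOn_actM hM).differentiableAt (isOpen_ball'.mem_nhds hz)
  have hu : DifferentiableAt ℂ u (actM (toBallMat X.τ₀ X.C r) z) :=
    hud.differentiableAt (isOpen_ball'.mem_nhds hMz)
  have hS : ∀ l, Summable fun o : X.Line =>
      c (Quot.out o) * datumS Φ (X.ballCoord (Quot.out o)) (actM (toBallMat X.τ₀ X.C r) z) l :=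
    fun l => (hsum _ hMz l).of_norm
  have hFs : Summable fun o : X.Line => ∑ l : Fin 2,
      (c (Quot.out o) * datumS Φ (X.ballCoord (Quot.out o)) (actM (toBallMat X.τ₀ X.C r) z) l) *
        pd k (fun w => actM (toBallMat X.τ₀ X.C r) w l) z :=
    summable_sum fun l _ => (hS l).mul_right _
  -- step 1: the chain rule and the identification at the point `actM M z`
  have h1 : pd k (u ∘ actM (toBallMat X.τ₀ X.C r)) z = ∑' o : X.Line, ∑ l : Fin 2,
      (c (Quot.out o) * datumS Φ (X.ballCoord (Quot.out o)) (actM (toBallMat X.τ₀ X.C r) z) l) *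
        pd k (fun w => actM (toBallMat X.τ₀ X.C r) w l) z := by
    rw [pd_comp k hu hφ]
    calc ∑ l, pd l u (actM (toBallMat X.τ₀ X.C r) z) * pd k (fun w => actM (toBallMat X.τ₀ X.C r) w l) z
        = ∑ l, (∑' o : X.Line, c (Quot.out o) * datumS Φ (X.ballCoord (Quot.out o))
            (actM (toBallMat X.τ₀ X.C r) z) l) * pd k (fun w => actM (toBallMat X.τ₀ X.C r) w l) z := by
          refine Finset.sum_congr rfl fun l _ => ?_
          rw [hid _ hMz l, T4Data.theta]
      _ = ∑ l, ∑' o : X.Line, (c (Quot.out o) * datumS Φ (X.ballCoord (Quot.out o))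
            (actM (toBallMat X.τ₀ X.C r) z) l) * pd k (fun w => actM (toBallMat X.τ₀ X.C r) w l) z := by
          refine Finset.sum_congr rfl fun l _ => ?_
          rw [tsum_mul_right]
      _ = _ := (Summable.tsum_finsetSum fun l _ => (hS l).mul_right _).symm
  -- step 2: the reindexing `o ↦ r · o` and `equiv`
  have hr' : IsUnit r.det := isUnit_det_of_isUnitaryOf X hr
  have h2 : ∀ o : X.Line, (∑ l : Fin 2,
      (c (Quot.out (lineEquiv X r hr' o)) * datumS Φ (X.ballCoord (Quot.out (lineEquiv X r hr' o)))
        (actM (toBallMat X.τ₀ X.C r) z) l) * pd k (fun w => actM (toBallMat X.τ₀ X.C r) w l) z) =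
      c (r *ᵥ Quot.out o) * datumS Φ (X.ballCoord (Quot.out o)) z k := by
    intro o
    rw [lineEquiv_apply]
    simp only [summand_out_mk X Φ c hw]
    rw [ballCoord_mulVec]
    have hE := hequiv (toBallMat X.τ₀ X.C r) (isUnitaryOf_J_of_conjTranspose hM) (X.ballCoord (Quot.out o))
      z hz k
    rw [← hE, Finset.mul_sum]
    refine Finset.sum_congr rfl fun l _ => ?_
    ring
  have h3 : Summable fun o : X.Line => c (r *ᵥ Quot.out o) * datumS Φ (X.ballCoord (Quot.out o)) z k := by
    have hFe := ((lineEquiv X r hr').summable_iff).mpr hFs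
    exact hFe.congr h2
  refine ⟨?_, h3⟩
  rw [h1, ← (lineEquiv X r hr').tsum_eq]
  exact tsum_congr h2

end Main

end HeckeEquivariance

open HeckeEquivariance

namespace T4Data

variable (X : T4Data)

/-- **L3.1 HECKE EQUIVARIANCE OF THETA SERIES (prover item; consumed by L3.2).** From the identification, the
`Γ`-invariance of `c`, the weight, the `U(2,1)`-equivariance of the datum (`ThetaData.equiv`, for
`M = toBallMat τ₀ C r`, `r` a coset representative — `Cᴴ H C = ±J` makes it unitary for `J`) and the chain rule for
`pd` of `a ∘ actM(M(r))` (typer-2's TargetCalculus: `comp` of a translate, `pd` of a composite), rearranging the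
absolutely convergent series.  Statement verbatim from `Tier4/Line3/Skeleton.lean` v0.7 L682. -/
theorem pd_heckeTranslate (D : X.ThetaData) : X.HeckeEquivariant D.Φ := by
  intro i σ hσ c hid _hinv hw hsum K h hK z hz k
  -- the locally uniform majorant gives pointwise absolute convergence on the ball
  have hsum' : ∀ z ∈ ball, ∀ k,
      Summable fun o : X.Line => ‖c (Quot.out o) * datumS D.Φ (X.ballCoord (Quot.out o)) z k‖ := by
    intro z hz k
    obtain ⟨g, hg, hle⟩ := hsum {z} isCompact_singleton (by simpa using hz) k
    exact Summable.of_nonneg_of_le (fun o => norm_nonneg _) (fun o => hle z (Set.mem_singleton z) o) hg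
  -- the corner function and its holomorphy on the ball
  set u : (Fin 2 → ℂ) → ℂ := comp (X.T i) σ hσ (X.a i) with hudef
  have hud : DifferentiableOn ℂ u ball := by
    have ha : DifferentiableOn ℂ (X.a i) ball := (X.ha i).1
    exact (differentiableOn_pi.mp ha) ⟨σ, hσ⟩
  -- every representative gives a differentiable composite and the per-representative identity
  have hdiff : ∀ t ∈ h.terms, ∀ r ∈ t.2,
      DifferentiableAt ℂ (fun w => u (actM (toBallMat X.τ₀ X.C r) w)) z := by
    intro t ht r hr
    have hM := toBallMat_J_of_unitary X (isUnitaryOf_of_isFor X K hK ht hr)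
    have hφ : DifferentiableAt ℂ (actM (toBallMat X.τ₀ X.C r)) z :=
      (differentiableOn_actM hM).differentiableAt (isOpen_ball'.mem_nhds hz)
    have hMz := actM_mem_ball hM hz
    exact (hud.differentiableAt (isOpen_ball'.mem_nhds hMz)).comp z hφ
  have hkey : ∀ t ∈ h.terms, ∀ r ∈ t.2,
      pd k (u ∘ actM (toBallMat X.τ₀ X.C r)) z =
        ∑' o : X.Line, c (r *ᵥ Quot.out o) * datumS D.Φ (X.ballCoord (Quot.out o)) z k ∧
      Summable (fun o : X.Line => c (r *ᵥ Quot.out o) * datumS D.Φ (X.ballCoord (Quot.out o)) z k) :=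
    fun t ht r hr =>
      pd_comp_actM X D.Φ c u hud hid hw hsum' D.equiv (isUnitaryOf_of_isFor X K hK ht hr) hz k
  -- the left side: `pd` through the finite Hecke sum
  have hL : pd k (heckeTranslate X.τ₀ X.C h u) z =
      (h.terms.map (fun t => t.1 • ∑ r ∈ t.2,
        ∑' o : X.Line, c (r *ᵥ Quot.out o) * datumS D.Φ (X.ballCoord (Quot.out o)) z k)).sum := by
    show pd k (fun w => (h.terms.map (fun t =>
      t.1 • (t.2.sum (fun r => u (actM (toBallMat X.τ₀ X.C r) w))))).sum) z = _
    rw [pd_list_sum k h.terms (fun t w => t.1 • (t.2.sum (fun r => u (actM (toBallMat X.τ₀ X.C r) w))))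
      (fun t ht => differentiableAt_zsmul t.1 (DifferentiableAt.fun_sum fun r hr => hdiff t ht r hr))]
    congr 1
    refine List.map_congr_left fun t ht => ?_
    rw [pd_zsmul k t.1 (f := fun w => ∑ r ∈ t.2, u (actM (toBallMat X.τ₀ X.C r) w))
      (DifferentiableAt.fun_sum fun r hr => hdiff t ht r hr)]
    congr 1
    rw [pd_finset_sum k t.2 (fun r w => u (actM (toBallMat X.τ₀ X.C r) w)) (fun r hr => hdiff t ht r hr)]
    refine Finset.sum_congr rfl fun r hr => ?_
    exact (hkey t ht r hr).1
  -- the right side: the theta series of the moved coefficient function, finite sums pulled out of the `tsum`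
  have hR : X.theta D.Φ (X.heckeAct h c) z k =
      (h.terms.map (fun t => t.1 • ∑ r ∈ t.2,
        ∑' o : X.Line, c (r *ᵥ Quot.out o) * datumS D.Φ (X.ballCoord (Quot.out o)) z k)).sum := by
    have hA : ∀ t ∈ h.terms, Summable (fun o : X.Line =>
        (t.1 • ∑ r ∈ t.2, c (r *ᵥ Quot.out o)) * datumS D.Φ (X.ballCoord (Quot.out o)) z k) := by
      intro t ht
      have heq : (fun o : X.Line =>
          (t.1 • ∑ r ∈ t.2, c (r *ᵥ Quot.out o)) * datumS D.Φ (X.ballCoord (Quot.out o)) z k) =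
          fun (o : X.Line) => (t.1 : ℂ) * ∑ r ∈ t.2,
            c (r *ᵥ Quot.out o) * datumS D.Φ (X.ballCoord (Quot.out o)) z k := by
        funext o
        rw [zsmul_eq_mul, mul_assoc, Finset.sum_mul]
      rw [heq]
      exact (summable_sum fun r hr => (hkey t ht r hr).2).mul_left _
    have hT := (tsum_list_sum (β := X.Line) h.terms (fun t (o : X.Line) =>
      (t.1 • ∑ r ∈ t.2, c (r *ᵥ Quot.out o)) * datumS D.Φ (X.ballCoord (Quot.out o)) z k) hA).2
    unfold T4Data.theta T4Data.heckeAct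
    have hmul : ∀ o : X.Line,
        (h.terms.map (fun t => t.1 • ∑ r ∈ t.2, c (r *ᵥ Quot.out o))).sum *
          datumS D.Φ (X.ballCoord (Quot.out o)) z k =
        (h.terms.map (fun t =>
          (t.1 • ∑ r ∈ t.2, c (r *ᵥ Quot.out o)) * datumS D.Φ (X.ballCoord (Quot.out o)) z k)).sum :=
      fun o => (List.sum_map_mul_right _ _ _).symm
    rw [tsum_congr hmul, hT]
    congr 1
    refine List.map_congr_left fun t ht => ?_
    have heq : (fun o : X.Line =>
        (t.1 • ∑ r ∈ t.2, c (r *ᵥ Quot.out o)) * datumS D.Φ (X.ballCoord (Quot.out o)) z k) =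
        fun (o : X.Line) => (t.1 : ℂ) * ∑ r ∈ t.2,
          c (r *ᵥ Quot.out o) * datumS D.Φ (X.ballCoord (Quot.out o)) z k := by
      funext o
      rw [zsmul_eq_mul, mul_assoc, Finset.sum_mul]
    rw [heq, Summable.tsum_mul_left _ (summable_sum fun r hr => (hkey t ht r hr).2),
      Summable.tsum_finsetSum fun r hr => (hkey t ht r hr).2, zsmul_eq_mul]
  rw [comp_heckeTranslate, hL, hR]

end T4Data

end Summit.Ventures.HodgeRepro.Tier4.Line3

end
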